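import Mathlib
import Summits.Ventures.PercRepro2.SwOutAll
import Summits.Ventures.PercRepro2.SwOutArmFlip
import Summits.Ventures.PercRepro2.SwOutJunctionsSplit

/-!
# The split at an arbitrary set of vertices (blind cell PercRepro2, night-4 g11, 2026-08-25;
proofs/NIGHT4-G11.md §5(5))

`splitEndsS ends S` for a set `S` that need not be independent: an edge with both ends in `S`
(an INTERNAL edge, `Internal`) becomes the loop `s(inr e, inr e)` at its own copy — an isolated
loop, in no split cluster but its own.  The connectivity transfer of `SwOutJunctionsSplit` holds
verbatim with «the other end is not in `S`» in place of independence (`cluster_splitS_subset'`,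
`conn_of_conn_splitS_inl'`, `conn_of_conn_splitS_inr'`, `conn_splitS_of_conn'`,
`inr_mem_cluster_splitS_iff'`, `inr_notMem_cluster_splitS_of_internal`).
-/

namespace Summit.Ventures.PercRepro2

namespace LocRows

open Hull

variable {V : Type*} {E : Type*} [Fintype E] [DecidableEq E]

open scoped Classical

section AdjSplit

variable {ends : E → Sym2 V} {S : Set V}

/-- An edge is **internal** to `S` if both its ends lie in `S`. -/
def Internal (ends : E → Sym2 V) (S : Set V) (e : E) : Prop := ∀ x ∈ ends e, x ∈ S

omit [Fintype E] [DecidableEq E] in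
/-- An edge `s(u, u')` with `u, u' ∈ S` is internal. -/
lemma internal_of_ends {e : E} {u u' : V} (hup : ends e = s(u, u')) (hu : u ∈ S) (hu' : u' ∈ S) :
    Internal ends S e := by
  intro x hx
  rw [hup, Sym2.mem_iff] at hx
  rcases hx with rfl | rfl
  · exact hu
  · exact hu'

omit [Fintype E] [DecidableEq E] in
/-- The other end of an internal edge lies in `S`. -/
lemma other_mem_of_internal {e : E} {u : V} (he : u ∈ ends e) (hi : Internal ends S e) :
    Sym2.Mem.other he ∈ S := hi _ (Sym2.other_mem he)

omit [Fintype E] [DecidableEq E] in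
/-- An edge at `u ∈ S` whose other end is outside `S` is not internal. -/
lemma not_internal_of_other_notMem {e : E} {u : V} (he : u ∈ ends e)
    (hp : Sym2.Mem.other he ∉ S) : ¬ Internal ends S e := fun hi => hp (hi _ (Sym2.other_mem he))

omit [Fintype E] [DecidableEq E] in
/-- The other end of a non-internal edge at `u ∈ S` is outside `S`. -/
lemma other_notMem_of_not_internal {e : E} {u : V} (hu : u ∈ S) (he : u ∈ ends e)
    (hi : ¬ Internal ends S e) : Sym2.Mem.other he ∉ S :=
  fun hp => hi (internal_of_ends (ends_eq_otherS he) hu hp)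

omit [Fintype E] [DecidableEq E] in
/-- The split edge of an internal edge is the loop at its copy. -/
lemma splitEndsS_of_internal {e : E} (hi : Internal ends S e) :
    splitEndsS ends S e = s(Sum.inr e, Sum.inr e) := by
  obtain ⟨x, y, hxy⟩ := exists_pairS (ends e)
  have hx : x ∈ S := hi x (by rw [hxy]; exact Sym2.mem_mk_left _ _)
  have hy : y ∈ S := hi y (by rw [hxy]; exact Sym2.mem_mk_right _ _)
  simp only [splitEndsS, hxy, Sym2.map_mk, if_pos hx, if_pos hy]

omit [Fintype E] [DecidableEq E] in
/-- The split edge of a non-internal edge at `u ∈ S`. -/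
lemma splitEndsS_of_not_internal {e : E} {u : V} (hu : u ∈ S) (he : u ∈ ends e)
    (hi : ¬ Internal ends S e) :
    splitEndsS ends S e = s(Sum.inr e, Sum.inl (Sym2.Mem.other he)) :=
  splitEndsS_of_mem (ends_eq_otherS he) hu (other_notMem_of_not_internal hu he hi)

omit [Fintype E] [DecidableEq E] in
/-- Two ends in `S` of a non-internal edge coincide, and their other ends coincide. -/
lemma other_eq_other_of_notMem {e : E} {u u' : V} (hu' : u' ∈ S) (he : u ∈ ends e)
    (he' : u' ∈ ends e) (hp : Sym2.Mem.other he ∉ S) :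
    u' = u ∧ Sym2.Mem.other he' = Sym2.Mem.other he := by
  have h1 : s(u', Sym2.Mem.other he') = s(u, Sym2.Mem.other he) :=
    (ends_eq_otherS he').symm.trans (ends_eq_otherS he)
  rw [Sym2.eq_iff] at h1
  rcases h1 with ⟨h2, h3⟩ | ⟨h2, _⟩
  · exact ⟨h2, h3⟩
  · exact absurd (h2 ▸ hu') hp

omit [Fintype E] [DecidableEq E] in
/-- Trichotomy for a split edge: no end in `S`, exactly one end in `S`, or internal. -/
lemma splitEndsS_cases (e : E) :
    (∃ x y, ends e = s(x, y) ∧ x ∉ S ∧ y ∉ S ∧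
      splitEndsS ends S e = s(Sum.inl x, Sum.inl y)) ∨
    (∃ u ∈ S, ∃ he : u ∈ ends e, Sym2.Mem.other he ∉ S ∧
      splitEndsS ends S e = s(Sum.inr e, Sum.inl (Sym2.Mem.other he))) ∨
    (Internal ends S e ∧ splitEndsS ends S e = s(Sum.inr e, Sum.inr e)) := by
  by_cases hi : Internal ends S e
  · exact Or.inr (Or.inr ⟨hi, splitEndsS_of_internal hi⟩)
  by_cases hu : ∃ u ∈ S, u ∈ ends e
  · obtain ⟨u, huS, hue⟩ := hu
    exact Or.inr (Or.inl ⟨u, huS, hue, other_notMem_of_not_internal huS hue hi,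
      splitEndsS_of_not_internal huS hue hi⟩)
  · push Not at hu
    obtain ⟨x, y, hxy⟩ := exists_pairS (ends e)
    have hx : x ∉ S := fun h' => hu x h' (by rw [hxy]; exact Sym2.mem_mk_left _ _)
    have hy : y ∉ S := fun h' => hu y h' (by rw [hxy]; exact Sym2.mem_mk_right _ _)
    exact Or.inl ⟨x, y, hxy, hx, hy, splitEndsS_of_notMem hxy hx hy⟩

/-! ## Connectivity transfer without independence -/

variable {ω : Config E} {a : V}

omit [Fintype E] [DecidableEq E] in
/-- **From the split graph to the graph**: an `inl`-vertex connected to `inl a` is connected to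
`a`; a copy `inr e` connected to `inl a` is the copy of a red non-internal edge at `S` whose other
end is connected to `a`. -/
theorem cluster_splitS_subset' :
    cluster (splitEndsS ends S) ω (Sum.inl a) ⊆
      {v' | Sum.elim (fun x => Conn ends ω a x)
        (fun e => ∃ u ∈ S, ∃ h : u ∈ ends e, Sym2.Mem.other h ∉ S ∧ ω e = true ∧
          Conn ends ω a (Sym2.Mem.other h)) v'} := by
  intro v' hv'
  refine mem_of_conn_of_closed (ends := splitEndsS ends S) (ω := ω) ?_ (conn_refl ends ω a) hv'
  intro x' hx' y' hxy
  obtain ⟨hne, e, he, hends⟩ := openGraph_adj.1 hxy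
  rcases splitEndsS_cases (ends := ends) (S := S) e with
    ⟨p, q, hpq, _, _, hsplit⟩ | ⟨u, huS, hue, hpS, hsplit⟩ | ⟨_, hsplit⟩
  · rw [hsplit, Sym2.eq_iff] at hends
    rcases hends with ⟨rfl, rfl⟩ | ⟨rfl, rfl⟩
    · exact mem_cluster_of_edge (v := a) hx' he hpq
    · exact mem_cluster_of_edge (v := a) hx' he (ends_swap hpq)
  · rw [hsplit, Sym2.eq_iff] at hends
    rcases hends with ⟨rfl, rfl⟩ | ⟨rfl, rfl⟩
    · obtain ⟨u', hu'S, h', _, _, hc⟩ := hx'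
      obtain ⟨_, hoth⟩ := other_eq_other_of_notMem hu'S hue h' hpS
      rw [hoth] at hc
      exact hc
    · exact ⟨u, huS, hue, hpS, he, hx'⟩
  · rw [hsplit, Sym2.eq_iff] at hends
    rcases hends with ⟨rfl, rfl⟩ | ⟨rfl, rfl⟩ <;> exact absurd rfl hne

omit [Fintype E] [DecidableEq E] in
/-- `inl b` connected to `inl a` in the split graph gives `b` connected to `a`. -/
theorem conn_of_conn_splitS_inl' {b : V}
    (h : Conn (splitEndsS ends S) ω (Sum.inl a) (Sum.inl b)) : Conn ends ω a b :=
  cluster_splitS_subset' h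

omit [Fintype E] [DecidableEq E] in
/-- A copy `inr e` connected to `inl a` in the split graph: `e` is a red non-internal edge at `S`
whose other end is connected to `a`. -/
theorem conn_of_conn_splitS_inr' {e : E}
    (h : Conn (splitEndsS ends S) ω (Sum.inl a) (Sum.inr e)) :
    ∃ u ∈ S, ∃ hu : u ∈ ends e, Sym2.Mem.other hu ∉ S ∧ ω e = true ∧
      Conn ends ω a (Sym2.Mem.other hu) :=
  cluster_splitS_subset' h

omit [Fintype E] [DecidableEq E] in
/-- **From the graph to the split graph**, away from `S`: if no vertex of `S` is in `C(a)` then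
everything connected to `a` is connected to `inl a` in the split graph. -/
theorem conn_splitS_of_conn' (hS : ∀ u ∈ S, u ∉ cluster ends ω a) {b : V}
    (hab : Conn ends ω a b) : Conn (splitEndsS ends S) ω (Sum.inl a) (Sum.inl b) := by
  refine mem_of_conn_of_closed (ends := ends) (ω := ω)
    (S := {x | Conn (splitEndsS ends S) ω (Sum.inl a) (Sum.inl x)}) ?_ (conn_refl _ _ _) hab
  intro x hx y hxy
  obtain ⟨hne, e, he, hends⟩ := openGraph_adj.1 hxy
  have hxa : x ∈ cluster ends ω a := conn_of_conn_splitS_inl' hx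
  have hya : y ∈ cluster ends ω a := mem_cluster_of_edge hxa he hends
  have hxS : x ∉ S := fun h' => hS x h' hxa
  have hyS : y ∉ S := fun h' => hS y h' hya
  exact mem_cluster_of_edge (v := Sum.inl a) hx he (splitEndsS_of_notMem hends hxS hyS)

omit [Fintype E] [DecidableEq E] in
/-- A copy `inr e` (non-internal edge `e` at `u ∈ S`) lies in the split cluster of `inl a` iff
`e` is red and its other end's copy does. -/
theorem inr_mem_cluster_splitS_iff' {e : E} {u : V} (hu : u ∈ S) (he : u ∈ ends e)
    (hp : Sym2.Mem.other he ∉ S) :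
    Sum.inr e ∈ cluster (splitEndsS ends S) ω (Sum.inl a) ↔
      ω e = true ∧ Sum.inl (Sym2.Mem.other he) ∈ cluster (splitEndsS ends S) ω (Sum.inl a) := by
  have hsplit : splitEndsS ends S e = s(Sum.inr e, Sum.inl (Sym2.Mem.other he)) :=
    splitEndsS_of_mem (ends_eq_otherS he) hu hp
  constructor
  · intro h
    have key : cluster (splitEndsS ends S) ω (Sum.inl a) ⊆
        {v' | v' ∈ cluster (splitEndsS ends S) ω (Sum.inl a) ∧ (v' ≠ Sum.inr e ∨
          (ω e = true ∧ Sum.inl (Sym2.Mem.other he) ∈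
            cluster (splitEndsS ends S) ω (Sum.inl a)))} := by
      intro v' hv'
      refine mem_of_conn_of_closed (ends := splitEndsS ends S) (ω := ω) ?_
        ⟨mem_cluster_self _ _ _, Or.inl Sum.inl_ne_inr⟩ hv'
      intro x' hx' y' hxy
      obtain ⟨hne, e', he', hends⟩ := openGraph_adj.1 hxy
      refine ⟨mem_cluster_of_adj hx'.1 hxy, ?_⟩
      by_cases hy : y' = Sum.inr e
      · subst hy
        have h1 : Sum.inr e ∈ splitEndsS ends S e' := by
          rw [hends]; exact Sym2.mem_mk_right _ _
        obtain ⟨rfl, _⟩ := inr_mem_splitEndsS_iff.1 h1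
        rw [hsplit, Sym2.eq_iff] at hends
        rcases hends with ⟨h2, _⟩ | ⟨_, h2⟩
        · exact absurd h2.symm hne
        · exact Or.inr ⟨he', by rw [h2]; exact hx'.1⟩
      · exact Or.inl hy
    rcases (key h).2 with h' | h'
    · exact absurd rfl h'
    · exact h'
  · rintro ⟨he', hc⟩
    exact mem_cluster_of_edge (v := Sum.inl a) hc he' (ends_swap hsplit)

omit [Fintype E] [DecidableEq E] in
/-- The copy of an internal edge is in no split cluster but its own. -/
lemma inr_notMem_cluster_splitS_of_internal {e : E} (hi : Internal ends S e) :
    Sum.inr e ∉ cluster (splitEndsS ends S) ω (Sum.inl a) := by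
  intro hmem
  have key : cluster (splitEndsS ends S) ω (Sum.inl a) ⊆ {v' | v' ≠ Sum.inr e} := by
    intro v' hv'
    refine mem_of_conn_of_closed (ends := splitEndsS ends S) (ω := ω) ?_ Sum.inl_ne_inr hv'
    intro x' hx' y' hxy
    obtain ⟨hne, e', _, hends⟩ := openGraph_adj.1 hxy
    intro hy
    subst hy
    have h1 : Sum.inr e ∈ splitEndsS ends S e' := by rw [hends]; exact Sym2.mem_mk_right _ _
    obtain ⟨rfl, _⟩ := inr_mem_splitEndsS_iff.1 h1
    rw [splitEndsS_of_internal hi, Sym2.eq_iff] at hends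
    rcases hends with ⟨h2, _⟩ | ⟨_, h2⟩ <;> exact hne h2.symm
  exact key hmem rfl

omit [Fintype E] [DecidableEq E] in
/-- A vertex of `S` is in no split cluster but its own (restated). -/
lemma inl_S_notMem_cluster_splitS' {u : V} (hu : u ∈ S) (hau : a ≠ u) :
    Sum.inl u ∉ cluster (splitEndsS ends S) ω (Sum.inl a) :=
  inl_S_notMem_cluster_splitS hu hau

end AdjSplit

end LocRows

end Summit.Ventures.PercRepro2
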